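import Mathlib
import Summits.NavierStokesRegularity.FluidComputer.TransportSkewLattice
import Literature.Analysis.FunctionSpaces.LatticeFirstOrderAdjoint
import HarnessLib

/-!
# The transport term on the lattice Sobolev scale, III: the dissipation sign and the one-sided bound `hA` for the linearised operator (instab g16, cell `ns-blowup`, 2026-08-27)

HONEST FRAMING (human ruling D-0035): nothing here is a claim about Navier–Stokes blow-up.
WHAT THIS IS NOT: not NS evidence — inequalities for coefficient families on `ℤ^d` composed from
parts I–II (`TransportCommutatorLattice`, `TransportSkewLattice`) and the tree's `Lattice*` toolkit.
No flow, set `W` or certificate is constructed; the host `U` is abstract data (a rapidly decreasing,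
real, divergence-free coefficient vector), not the ABC flow.

PURPOSE. The third (C2) input `hA` of `GalerkinOneSidedLipschitz.galerkin_oneSided_uniform_transport`
(p472299; `HOME/instab/BETA2-SPEC.md` §5/§5′): a ONE-SIDED bound in the `H²` pairing for the
linearised operator `A d = νΔd − ℙ(T_U d + T_d U)` (transport by the host + stretching of the host),
with ANY constant. Here, with `G = Λ² d`:

* §1 `re_pairing_freqDeriv_freqDeriv_le_zero`, `re_pairing_wmul_two_laplacian_le_zero` —
  DISSIPATION HAS A SIGN: `Re ⟨Λ² ∂_j∂_j d, Λ² d⟩ = −‖∂_j Λ² d‖₀² ≤ 0`, hence `Re ⟨Λ² Δ d, Λ² d⟩ ≤ 0`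
  (`Lattice.pairing_freqDeriv_left`, `Lattice.toReal_eNormSq_zero_eq_re_pairing`).
* §2 `abs_re_pairing_wmul_two_stretching_le` — STRETCHING costs the first-slot bound of part I:
  `|Re ⟨Λ² T_c x, Λ² d⟩| ≤ 2·(2π card d)·A₃(x)·‖c‖₂·‖d‖₂` (`eNormSq_two_transport_le` + Cauchy–Schwarz
  `Lattice.norm_pairing_le`).
* §3 `re_pairing_wmul_two_linearised_le` — **`hA`**: for `ν ≥ 0`, a rapidly decreasing real
  divergence-free host coefficient vector `U = (U_j)` with a `V`-valued companion family `Uv`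
  (the same host read as the ADVECTED target), coordinate functionals `π_j` of norm `≤ 1`, and
  `d ∈ H³` (finiteness only):
  `Re ⟨Λ²(νΔd − T_U d − T_{π∘d} Uv), Λ² d⟩ ≤ (6π ∑_j A₂(U_j) + 4π·card d·A₃(Uv)) ‖d‖₂²`
  — the three pieces §1, part II's transport form, §2. The Leray symbol is omitted here: by
  `TransportSkewLattice.pairing_apply_eq_of_isSelfAdjoint` it drops out against a divergence-free `d`.

All constants are explicit and crude (any `ω₀` serves (C2)); nothing is optimised.
-/

noncomputable section

namespace Summit.NavierStokesRegularity.FluidComputer.TransportLinearisedLattice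

open Finset
open Literature.Analysis.FunctionSpaces Literature.Analysis.FunctionSpaces.Lattice
open Literature.Analysis.FunctionSpaces.Torus
open Summit.NavierStokesRegularity.FluidComputer.TransportCommutatorLattice
open Summit.NavierStokesRegularity.FluidComputer.TransportSkewLattice
open scoped ENNReal NNReal InnerProductSpace ComplexConjugate

variable {d : Type*} [Fintype d]
variable {V : Type*} [NormedAddCommGroup V] [InnerProductSpace ℂ V] [CompleteSpace V]

/-! ## §0 A finiteness helper -/

omit [InnerProductSpace ℂ V] [CompleteSpace V] in
/-- Finite sums of `H^s` families are in `H^s` (Minkowski `Lattice.eNorm_add_le`). -/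
theorem eNormSq_finset_sum_lt_top {ι : Type*} (F : Finset ι) {s : ℝ}
    {c : ι → (d → ℤ) → V} (h : ∀ i ∈ F, eNormSq s (c i) < ∞) : eNormSq s (∑ i ∈ F, c i) < ∞ := by
  classical
  induction F using Finset.induction_on with
  | empty => simp [eNormSq]
  | insert i F hi ih =>
      rw [Finset.sum_insert hi, ← eNorm_lt_top_iff]
      refine (eNorm_add_le s _ _).trans_lt (ENNReal.add_lt_top.2 ⟨?_, ?_⟩)
      · exact eNorm_lt_top_iff.2 (h i (Finset.mem_insert_self i F))
      · exact eNorm_lt_top_iff.2 (ih fun k hk => h k (Finset.mem_insert_of_mem hk))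

/-! ## §1 Dissipation has a sign -/

omit [CompleteSpace V] in
/-- `Re ⟨∂_j ∂_j G, G⟩ = −‖∂_j G‖₀² ≤ 0` for `G ∈ H¹` (skew-adjointness of `∂_j`). -/
theorem re_pairing_freqDeriv_freqDeriv_le_zero (j : d) {G : (d → ℤ) → V} (hG : eNormSq 1 G < ∞) :
    (pairing (freqDeriv j (freqDeriv j G)) G).re ≤ 0 := by
  have hdG : eNormSq 0 (freqDeriv j G) < ∞ :=
    (eNormSq_freqDeriv_le 0 j G).trans_lt (ENNReal.mul_lt_top ENNReal.ofReal_lt_top (by rwa [zero_add]))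
  rw [pairing_freqDeriv_left j (freqDeriv j G) G, Complex.neg_re, neg_nonpos,
    ← toReal_eNormSq_zero_eq_re_pairing hdG]
  exact ENNReal.toReal_nonneg

omit [CompleteSpace V] in
/-- **Dissipation has a sign in `H²`**: `Re ⟨Λ² (∑_j ∂_j∂_j d), Λ² d⟩ ≤ 0` for `d ∈ H³` (finiteness
only). -/
theorem re_pairing_wmul_two_laplacian_le_zero {u : (d → ℤ) → V} (hu : eNormSq 3 u < ∞) :
    (pairing (wmul 2 (∑ j, freqDeriv j (freqDeriv j u))) (wmul 2 u)).re ≤ 0 := by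
  have hG1 : eNormSq 1 (wmul 2 u) < ∞ := by rw [eNormSq_wmul]; norm_num; exact hu
  -- rewrite `Λ² ∂_j∂_j u = ∂_j∂_j (Λ² u)`
  have hcomm : wmul 2 (∑ j, freqDeriv j (freqDeriv j u)) =
      ∑ j, freqDeriv j (freqDeriv j (wmul 2 u)) := by
    rw [wmul_finset_sum]
    exact Finset.sum_congr rfl fun j _ => by rw [wmul_freqDeriv, wmul_freqDeriv]
  -- termwise summability (H⁻¹ against H¹)
  have hs : ∀ j, Summable fun k => ⟪freqDeriv j (freqDeriv j (wmul 2 u)) k, wmul 2 u k⟫_ℂ := by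
    intro j
    have h1 : eNormSq 0 (freqDeriv j (wmul 2 u)) < ∞ :=
      (eNormSq_freqDeriv_le 0 j _).trans_lt (ENNReal.mul_lt_top ENNReal.ofReal_lt_top (by
        rwa [zero_add]))
    have h2 : eNormSq (-1) (freqDeriv j (freqDeriv j (wmul 2 u))) < ∞ :=
      (eNormSq_freqDeriv_le (-1) j _).trans_lt (ENNReal.mul_lt_top ENNReal.ofReal_lt_top (by
        rw [show (-1 : ℝ) + 1 = 0 by norm_num]; exact h1))
    exact summable_inner h2 (by rw [neg_neg]; exact hG1)
  rw [hcomm, pairing_finset_sum_left_of_summable _ fun j _ => hs j, Complex.re_sum]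
  exact Finset.sum_nonpos fun j _ => re_pairing_freqDeriv_freqDeriv_le_zero j hG1

/-! ## §2 Stretching costs the first-slot bound -/

omit [CompleteSpace V] in
/-- **The stretching term in `H²`**: with the advecting components dominated by `c`
(`|y_j(p)| ≤ ‖c p‖`) and the advected target `x` with `A₃(x) = ∑⟨l⟩³‖x l‖ < ∞`,
`|Re ⟨Λ² T_y x, Λ² v⟩| ≤ 2·(2π card d)·A₃(x)·‖c‖₂·‖v‖₂` for `c, v ∈ H²`. -/
theorem abs_re_pairing_wmul_two_stretching_le {E' : Type*} [NormedAddCommGroup E']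
    (y : d → (d → ℤ) → ℂ) (c : (d → ℤ) → E') (hyc : ∀ j p, ‖y j p‖ ≤ ‖c p‖)
    (x : (d → ℤ) → V) (hx : ∑' l, ENNReal.ofReal (sobolevWeight 3 l) * ‖x l‖ₑ < ∞)
    (hc : eNormSq 2 c < ∞) {v : (d → ℤ) → V} (hv : eNormSq 2 v < ∞) :
    |(pairing (wmul 2 (∑ j, conv (scal (y j)) (freqDeriv j x))) (wmul 2 v)).re| ≤
      2 * ((Fintype.card d : ℝ) * (2 * Real.pi)) *
        (∑' l, ENNReal.ofReal (sobolevWeight 3 l) * ‖x l‖ₑ).toReal *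
          (eNorm 2 c).toReal * (eNorm 2 v).toReal := by
  set T := ∑ j, conv (scal (y j) : (d → ℤ) → (V →L[ℂ] V)) (freqDeriv j x) with hT
  set A₃ := ∑' l, ENNReal.ofReal (sobolevWeight 3 l) * ‖x l‖ₑ with hA₃
  have hsq : eNormSq 2 T ≤ 4 * ((Fintype.card d : ℝ≥0∞) * ENNReal.ofReal (2 * Real.pi)) ^ 2 *
      A₃ ^ 2 * eNormSq 2 c := eNormSq_two_transport_le y c hyc x
  -- pass to `eNorm` (square roots)
  have hT2 : eNorm 2 T ≤ 2 * ((Fintype.card d : ℝ≥0∞) * ENNReal.ofReal (2 * Real.pi)) * A₃ *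
      eNorm 2 c := by
    have h4 : (4 : ℝ≥0∞) = 2 ^ 2 := by norm_num
    rw [h4, ← mul_pow, ← mul_pow, ← eNorm_pow_two, ← eNorm_pow_two 2 c, ← mul_pow] at hsq
    exact (ENNReal.pow_le_pow_left_iff two_ne_zero).1 hsq
  have hTfin : eNormSq 2 T < ∞ := by
    refine hsq.trans_lt ?_
    refine ENNReal.mul_lt_top (ENNReal.mul_lt_top (ENNReal.mul_lt_top (by norm_num)
      (ENNReal.pow_lt_top (ENNReal.mul_lt_top (by simp) ENNReal.ofReal_lt_top))) (ENNReal.pow_lt_top hx)) hc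
  have hT0 : eNormSq 0 (wmul 2 T) < ∞ := by rw [eNormSq_wmul, zero_add]; exact hTfin
  have hv0 : eNormSq (-0) (wmul 2 v) < ∞ := by rw [neg_zero, eNormSq_wmul, zero_add]; exact hv
  have hfin : 2 * ((Fintype.card d : ℝ≥0∞) * ENNReal.ofReal (2 * Real.pi)) * A₃ * eNorm 2 c ≠ ∞ :=
    ENNReal.mul_ne_top (ENNReal.mul_ne_top (ENNReal.mul_ne_top (by norm_num)
      (ENNReal.mul_ne_top (by simp) ENNReal.ofReal_ne_top)) hx.ne) (eNorm_lt_top_iff.2 hc).ne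
  have hT2' : eNorm 0 (wmul 2 T) ≤ 2 * ((Fintype.card d : ℝ≥0∞) * ENNReal.ofReal (2 * Real.pi)) *
      A₃ * eNorm 2 c := by rw [eNorm_wmul, zero_add]; exact hT2
  have hTreal : (eNorm 0 (wmul 2 T)).toReal ≤ 2 * ((Fintype.card d : ℝ) * (2 * Real.pi)) *
      A₃.toReal * (eNorm 2 c).toReal := by
    have := ENNReal.toReal_mono hfin hT2'
    rw [ENNReal.toReal_mul, ENNReal.toReal_mul, ENNReal.toReal_mul, ENNReal.toReal_mul,
      ENNReal.toReal_ofReal (by positivity)] at this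
    simpa using this
  have hv' : (eNorm (-0) (wmul 2 v)).toReal = (eNorm 2 v).toReal := by
    rw [neg_zero, eNorm_wmul, zero_add]
  calc |(pairing (wmul 2 T) (wmul 2 v)).re| ≤ ‖pairing (wmul 2 T) (wmul 2 v)‖ :=
        Complex.abs_re_le_norm _
    _ ≤ (eNorm 0 (wmul 2 T)).toReal * (eNorm (-0) (wmul 2 v)).toReal := norm_pairing_le hT0 hv0
    _ ≤ (2 * ((Fintype.card d : ℝ) * (2 * Real.pi)) * A₃.toReal * (eNorm 2 c).toReal) *
          (eNorm 2 v).toReal := by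
        rw [hv']; exact mul_le_mul_of_nonneg_right hTreal ENNReal.toReal_nonneg

/-! ## §3 The one-sided bound `hA` for the linearised operator -/

/-- **`hA` for `A d = νΔd − T_U d − T_{π∘d} Uv` in the `H²` pairing** (Leray symbol omitted — it
drops out against divergence-free `d` by part II §3): for `ν ≥ 0`, a rapidly decreasing, real,
divergence-free host coefficient vector `U`, its `V`-valued companion `Uv` with `A₃(Uv) < ∞`,
coordinate functionals `π_j` of norm `≤ 1`, and `d ∈ H³`,
`Re ⟨Λ²(ν ∑_j ∂_j∂_j d − T_U d − T_{π∘d} Uv), Λ² d⟩ ≤ (6π ∑_j A₂(U_j) + 4π·card d·A₃(Uv))·‖d‖₂²`. -/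
theorem re_pairing_wmul_two_linearised_le {ν : ℝ} (hν : 0 ≤ ν) (U : d → (d → ℤ) → ℂ)
    (hU : ∀ j, RapidDecay (U j)) (hUreal : ∀ j p, U j (-p) = conj (U j p))
    (hUdiv : ∑ j, freqDeriv j (U j) = 0) (Uv : (d → ℤ) → V)
    (hUv : ∑' l, ENNReal.ofReal (sobolevWeight 3 l) * ‖Uv l‖ₑ < ∞)
    (π : d → (V →L[ℂ] ℂ)) (hπ : ∀ j, ‖π j‖ ≤ 1) {u : (d → ℤ) → V} (hu : eNormSq 3 u < ∞) :
    (pairing (wmul 2 ((ν : ℂ) • (∑ j, freqDeriv j (freqDeriv j u))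
        - ∑ j, conv (scal (U j)) (freqDeriv j u)
        - ∑ j, conv (scal (fun p => π j (u p))) (freqDeriv j Uv))) (wmul 2 u)).re ≤
      (6 * Real.pi * (∑ j, (symbNorm 2 (scal (U j) : (d → ℤ) → (V →L[ℂ] V))).toReal)
        + 2 * ((Fintype.card d : ℝ) * (2 * Real.pi)) *
          (∑' l, ENNReal.ofReal (sobolevWeight 3 l) * ‖Uv l‖ₑ).toReal) * (eNorm 2 u).toReal ^ 2 := by
  -- names
  set L := ∑ j, freqDeriv j (freqDeriv j u) with hL
  set T₁ := ∑ j, conv (scal (U j) : (d → ℤ) → (V →L[ℂ] V)) (freqDeriv j u) with hT₁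
  set T₂ := ∑ j, conv (scal (fun p => π j (u p)) : (d → ℤ) → (V →L[ℂ] V)) (freqDeriv j Uv) with hT₂
  set G := wmul 2 u with hG
  have hu2 : eNormSq 2 u < ∞ := (eNormSq_mono (by norm_num : (2 : ℝ) ≤ 3) u).trans_lt hu
  have hG1 : eNormSq 1 G < ∞ := by rw [hG, eNormSq_wmul]; norm_num; exact hu
  have hG0' : eNormSq (-0) G < ∞ := by
    rw [neg_zero]; exact (eNormSq_mono zero_le_one _).trans_lt hG1
  have hGm1 : eNormSq (-(-1)) G < ∞ := by rw [neg_neg]; exact hG1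
  -- (1) summability of the three pairings against G
  have hsL : Summable fun k => ⟪wmul 2 ((ν : ℂ) • L) k, G k⟫_ℂ := by
    -- `Λ² (ν L) ∈ H⁻¹`
    have hL1 : eNormSq (-1) (wmul 2 ((ν : ℂ) • L)) < ∞ := by
      rw [eNormSq_wmul, show (-1 : ℝ) + 2 = 1 by norm_num, eNormSq_const_smul]
      refine ENNReal.mul_lt_top (by simp) ?_
      -- `L ∈ H¹` from `u ∈ H³`
      have h2j : ∀ j, eNormSq 2 (freqDeriv j u) < ∞ := fun j =>
        (eNormSq_freqDeriv_le 2 j _).trans_lt (ENNReal.mul_lt_top ENNReal.ofReal_lt_top (by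
          rw [show (2 : ℝ) + 1 = 3 by norm_num]; exact hu))
      have : ∀ j, eNormSq 1 (freqDeriv j (freqDeriv j u)) < ∞ := fun j =>
        (eNormSq_freqDeriv_le 1 j _).trans_lt (ENNReal.mul_lt_top ENNReal.ofReal_lt_top (by
          rw [show (1 : ℝ) + 1 = 2 by norm_num]; exact h2j j))
      rw [hL]
      exact eNormSq_finset_sum_lt_top _ fun j _ => this j
    exact summable_inner hL1 hGm1
  have hT₁fin : eNormSq 0 (wmul 2 T₁) < ∞ := by
    rw [eNormSq_wmul, zero_add, hT₁]
    refine eNormSq_finset_sum_lt_top _ fun j _ => eNormSq_conv_lt_top (hU j).scal ?_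
    exact (eNormSq_freqDeriv_le 2 j u).trans_lt (ENNReal.mul_lt_top ENNReal.ofReal_lt_top (by
      rw [show (2 : ℝ) + 1 = 3 by norm_num]; exact hu))
  have hsT₁ : Summable fun k => ⟪wmul 2 T₁ k, G k⟫_ℂ := summable_inner hT₁fin hG0'
  have hyc : ∀ j p, ‖(fun p => π j (u p)) p‖ ≤ ‖u p‖ := fun j p =>
    ((π j).le_opNorm (u p)).trans (mul_le_of_le_one_left (norm_nonneg _) (hπ j))
  have hT₂fin : eNormSq 0 (wmul 2 T₂) < ∞ := by
    rw [eNormSq_wmul, zero_add, hT₂]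
    refine (eNormSq_two_transport_le _ u hyc Uv).trans_lt ?_
    exact ENNReal.mul_lt_top (ENNReal.mul_lt_top (ENNReal.mul_lt_top (by norm_num)
      (ENNReal.pow_lt_top (ENNReal.mul_lt_top (by simp) ENNReal.ofReal_lt_top)))
      (ENNReal.pow_lt_top hUv)) hu2
  have hsT₂ : Summable fun k => ⟪wmul 2 T₂ k, G k⟫_ℂ := summable_inner hT₂fin hG0'
  -- (2) split the pairing
  have hsplit : pairing (wmul 2 ((ν : ℂ) • L - T₁ - T₂)) G =
      pairing (wmul 2 ((ν : ℂ) • L)) G - pairing (wmul 2 T₁) G - pairing (wmul 2 T₂) G := by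
    have hw : wmul 2 ((ν : ℂ) • L - T₁ - T₂) = wmul 2 ((ν : ℂ) • L) - wmul 2 T₁ - wmul 2 T₂ := by
      funext k; simp only [wmul_apply, Pi.sub_apply, smul_sub]
    have hs12 : Summable fun k => ⟪(wmul 2 ((ν : ℂ) • L) - wmul 2 T₁) k, G k⟫_ℂ :=
      (hsL.sub hsT₁).congr fun k => by rw [Pi.sub_apply, inner_sub_left]
    rw [hw, pairing_sub_left hs12 hsT₂, pairing_sub_left hsL hsT₁]
  -- (3) the three bounds
  have h1 : (pairing (wmul 2 ((ν : ℂ) • L)) G).re ≤ 0 := by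
    have hw : wmul 2 ((ν : ℂ) • L) = (ν : ℂ) • wmul 2 L := by
      funext k; simp only [wmul_apply, Pi.smul_apply, smul_smul, mul_comm]
    rw [hw, pairing_smul_left, Complex.mul_re, Complex.conj_re, Complex.conj_im,
      Complex.ofReal_re, Complex.ofReal_im, neg_zero, zero_mul, sub_zero]
    exact mul_nonpos_of_nonneg_of_nonpos hν (re_pairing_wmul_two_laplacian_le_zero hu)
  have h2 : |(pairing (wmul 2 T₁) G).re| ≤
      6 * Real.pi * (∑ j, (symbNorm 2 (scal (U j) : (d → ℤ) → (V →L[ℂ] V))).toReal) *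
        (eNorm 2 u).toReal ^ 2 := abs_re_pairing_wmul_two_transport_le U hU hUreal hUdiv hu
  have h3 : |(pairing (wmul 2 T₂) G).re| ≤ 2 * ((Fintype.card d : ℝ) * (2 * Real.pi)) *
      (∑' l, ENNReal.ofReal (sobolevWeight 3 l) * ‖Uv l‖ₑ).toReal *
        (eNorm 2 u).toReal * (eNorm 2 u).toReal :=
    abs_re_pairing_wmul_two_stretching_le _ u hyc Uv hUv hu2 hu2
  rw [hsplit, Complex.sub_re, Complex.sub_re]
  have h2' := neg_le_of_abs_le h2
  have h3' := neg_le_of_abs_le h3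
  rw [mul_assoc, ← sq] at h3'
  have hn : 0 ≤ (eNorm 2 u).toReal ^ 2 := sq_nonneg _
  linarith [h1, h2', h3']

end Summit.NavierStokesRegularity.FluidComputer.TransportLinearisedLattice

end
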